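import Mathlib
import HarnessLib
import Literature.Analysis.FluidPDE.MildSolution
import Literature.Analysis.UnboundedOperators.HeatKernelBoundedData
import Literature.Analysis.FluidPDE.NewtonKernel
import Literature.Analysis.FluidPDE.TaoEnergyLocalisationPressure

/-!
# Route `QuarterLogPincer`, crux `TypeIQuantSubcubicExp` (stmt-NavierStokesRegularity-24077), line `quiet_collar` — towards QP2
# `stub_cutPair`: THE HEAT COMMUTATOR SUP BOUND `‖χ·e^{tΔ}f − e^{tΔ}(χf)‖_∞ ≤ Lip(χ)·‖f‖_∞·2·2^{3/2}√t`

The first of the two commutators in the mild defect of the cut reference (`…QuietCollarCutReference.mildDefect_cutRef_eq`):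
for a Lipschitz scalar `χ` (constant `Lχ`; the cut-off `radialCutoff r (r+L)` has `Lχ ≲ 1/L`) and a bounded continuous field `f`,
`‖χ(x)·e^{tΔ}f(x) − e^{tΔ}(χ·f)(x)‖ ≤ Lχ·‖f‖_∞·∫G_t(z)‖z‖dz ≤ Lχ·‖f‖_∞·2·2^{n/2}√t` — polynomially small in `1/L`, uniformly in the
radius (`norm_heatCommutator_smul_le`; first moment of the heat kernel `integral_heatKernel_mul_norm_le`).  r-INDEPENDENT groundwork
for QP2 (DIRECTOR-NS KEY-NS #178).  HONEST FRAME: an elementary heat-kernel estimate; nothing here bears on 24077, W7 or Navier–Stokes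
regularity (OPEN).  Helper of the pub-ns-dss typer (g36), `--supports 24077`.
-/

noncomputable section

set_option linter.dupNamespace false

namespace Summit.NavierStokesRegularity.NavierStokesRegularity.Cruxes.TypeIQuantSubcubicExp.QuietCollar

open MeasureTheory Set Function Filter Real Metric
open scoped ENNReal NNReal Topology
open Literature.Analysis Literature.Analysis.FluidPDE Literature.Analysis.UnboundedOperators

/-- **HEAT COMMUTATOR SUP BOUND**: `‖χ(x)·e^{tΔ}f(x) − e^{tΔ}(χ·f)(x)‖ ≤ Lχ·B·(2·2^{n/2}·t^{1/2})` for `χ` `Lχ`-Lipschitz and bounded,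
`f` continuous with `‖f‖ ≤ B`, `t > 0` (`χ e^{tΔ}f − e^{tΔ}(χf) = ∫ G_t(y)(χ(x) − χ(x−y))f(x−y)dy`). [folklore] -/
theorem norm_heatCommutator_smul_le {χ : EuclideanSpace ℝ (Fin 3) → ℝ} {f : EuclideanSpace ℝ (Fin 3) → EuclideanSpace ℝ (Fin 3)}
    {Lχ Cχ B t : ℝ} (hχc : Continuous χ) (hL0 : 0 ≤ Lχ) (hχL : ∀ x y, ‖χ x - χ y‖ ≤ Lχ * ‖x - y‖)
    (hχB : ∀ z, ‖χ z‖ ≤ Cχ) (hf : Continuous f) (hB : ∀ z, ‖f z‖ ≤ B) (ht : 0 < t) (x : EuclideanSpace ℝ (Fin 3)) :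
    ‖χ x • heatExtension f t x - heatExtension (fun y => χ y • f y) t x‖ ≤
      Lχ * B * (2 * (2 : ℝ) ^ ((Module.finrank ℝ (EuclideanSpace ℝ (Fin 3)) : ℝ) / 2) * t ^ (1 / 2 : ℝ)) := by
  have hB0 : 0 ≤ B := (norm_nonneg _).trans (hB 0)
  -- both terms as heat-kernel integrals
  have hχf : Continuous fun y => χ y • f y := hχc.smul hf
  have hχfB : ∀ z, ‖χ z • f z‖ ≤ Cχ * B := fun z => by
    rw [norm_smul]; exact mul_le_mul (hχB z) (hB z) (norm_nonneg _) ((norm_nonneg _).trans (hχB z))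
  have hi1 := integrable_heatKernel_smul_of_bound hf hB ht x
  have hi2 := integrable_heatKernel_smul_of_bound hχf hχfB ht x
  have hrepr : χ x • heatExtension f t x - heatExtension (fun y => χ y • f y) t x =
      ∫ y, heatKernel t y • ((χ x - χ (x - y)) • f (x - y)) := by
    have hi1' : Integrable (fun y => χ x • (heatKernel t y • f (x - y))) := hi1.smul (χ x)
    rw [heatExtension_apply, heatExtension_apply, ← integral_smul, ← integral_sub hi1' hi2]
    refine integral_congr_ae (Eventually.of_forall fun y => ?_)
    simp only [smul_sub, sub_smul, smul_smul, mul_comm (heatKernel t y)]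
  rw [hrepr]
  -- pointwise bound of the integrand by `G_t(y)‖y‖ · Lχ B`
  have hpt : ∀ y, ‖heatKernel t y • ((χ x - χ (x - y)) • f (x - y))‖ ≤ (heatKernel t y * ‖y‖) * (Lχ * B) := by
    intro y
    rw [norm_smul, norm_smul, Real.norm_eq_abs, abs_of_nonneg (heatKernel_pos ht y).le]
    have h1 : ‖χ x - χ (x - y)‖ ≤ Lχ * ‖y‖ := by
      have := hχL x (x - y); rwa [sub_sub_cancel] at this
    have h2 : ‖χ x - χ (x - y)‖ * ‖f (x - y)‖ ≤ (Lχ * ‖y‖) * B :=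
      mul_le_mul h1 (hB _) (norm_nonneg _) (by positivity)
    calc heatKernel t y * (‖χ x - χ (x - y)‖ * ‖f (x - y)‖) ≤ heatKernel t y * ((Lχ * ‖y‖) * B) :=
          mul_le_mul_of_nonneg_left h2 (heatKernel_pos ht y).le
      _ = (heatKernel t y * ‖y‖) * (Lχ * B) := by ring
  calc ‖∫ y, heatKernel t y • ((χ x - χ (x - y)) • f (x - y))‖
      ≤ ∫ y, (heatKernel t y * ‖y‖) * (Lχ * B) :=
        norm_integral_le_of_norm_le ((integrable_heatKernel_mul_norm ht).mul_const _) (Eventually.of_forall hpt)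
    _ = (∫ y, heatKernel t y * ‖y‖) * (Lχ * B) := integral_mul_const _ _
    _ ≤ (2 * (2 : ℝ) ^ ((Module.finrank ℝ (EuclideanSpace ℝ (Fin 3)) : ℝ) / 2) * t ^ (1 / 2 : ℝ)) * (Lχ * B) :=
        mul_le_mul_of_nonneg_right (integral_heatKernel_mul_norm_le ht) (by positivity)
    _ = Lχ * B * (2 * (2 : ℝ) ^ ((Module.finrank ℝ (EuclideanSpace ℝ (Fin 3)) : ℝ) / 2) * t ^ (1 / 2 : ℝ)) := by ring

/-- The same with `heatFlow` (`= heatExtension` for `t > 0`). [folklore] -/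
theorem norm_heatFlow_commutator_smul_le {χ : EuclideanSpace ℝ (Fin 3) → ℝ} {f : EuclideanSpace ℝ (Fin 3) → EuclideanSpace ℝ (Fin 3)}
    {Lχ Cχ B t : ℝ} (hχc : Continuous χ) (hL0 : 0 ≤ Lχ) (hχL : ∀ x y, ‖χ x - χ y‖ ≤ Lχ * ‖x - y‖)
    (hχB : ∀ z, ‖χ z‖ ≤ Cχ) (hf : Continuous f) (hB : ∀ z, ‖f z‖ ≤ B) (ht : 0 < t) (x : EuclideanSpace ℝ (Fin 3)) :
    ‖χ x • heatFlow f t x - heatFlow (fun y => χ y • f y) t x‖ ≤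
      Lχ * B * (2 * (2 : ℝ) ^ ((Module.finrank ℝ (EuclideanSpace ℝ (Fin 3)) : ℝ) / 2) * t ^ (1 / 2 : ℝ)) := by
  rw [heatFlow_of_pos _ ht, heatFlow_of_pos _ ht]
  exact norm_heatCommutator_smul_le hχc hL0 hχL hχB hf hB ht x

/-! ### The radial cut-off `radialCutoff r R` is `C₁/(R−r)`-Lipschitz, uniformly in the radius -/

/-- **LIPSCHITZ BOUND OF THE RADIAL CUT-OFF, UNIFORM IN THE RADIUS**: there is an absolute `C₁ > 0` with
`|χ(x) − χ(y)| ≤ C₁/(R−r)·‖x−y‖` for `χ = radialCutoff r R`, all `0 ≤ r < R` (bridge `radialCutoff_eq_taoCutoff` to Tao's cut-off of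
width `(R²−r²)/R ≥ R−r`, and `exists_norm_fderiv_taoCutoff_le` + the mean value inequality `abs_taoCutoff_sub_le`). [folklore] -/
theorem exists_abs_radialCutoff_sub_le :
    ∃ C₁ : ℝ, 0 < C₁ ∧ ∀ r R : ℝ, 0 ≤ r → r < R → ∀ x y : EuclideanSpace ℝ (Fin 3),
      ‖(radialCutoff r R x : ℝ) - radialCutoff r R y‖ ≤ C₁ / (R - r) * ‖x - y‖ := by
  obtain ⟨C₁, hC₁, hC⟩ := exists_norm_fderiv_taoCutoff_le (E := EuclideanSpace ℝ (Fin 3))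
  refine ⟨C₁, hC₁, fun r R hr hrR x y => ?_⟩
  have hR : 0 < R := lt_of_le_of_lt hr hrR
  have hw : 0 < (R ^ 2 - r ^ 2) / R := div_pos (by nlinarith) hR
  have hfun : (radialCutoff r R : EuclideanSpace ℝ (Fin 3) → ℝ) = taoCutoff R ((R ^ 2 - r ^ 2) / R) :=
    funext fun z => radialCutoff_eq_taoCutoff hR.ne' z
  have h1 := abs_taoCutoff_sub_le (R := R) (r := (R ^ 2 - r ^ 2) / R) (C₁ := C₁) (fun z => hC R _ hw hR z) x y
  rw [← hfun] at h1
  rw [Real.norm_eq_abs]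
  refine h1.trans (mul_le_mul_of_nonneg_right ?_ (norm_nonneg _))
  refine div_le_div_of_nonneg_left hC₁.le (sub_pos.2 hrR) ?_
  rw [le_div_iff₀ hR]
  nlinarith

/-- **HEAT COMMUTATOR OF THE CUT REFERENCE**: `‖χ(x)·e^{tΔ}f(x) − e^{tΔ}(χf)(x)‖ ≤ C₁/(R−r)·B·(2·2^{n/2}·√t)` for `χ = radialCutoff r R`,
`0 ≤ r < R`, `f` continuous with `‖f‖ ≤ B`, `t > 0` — polynomially small in the collar width `R − r`, UNIFORMLY IN THE RADIUS `r`. [folklore] -/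
theorem exists_norm_heatFlow_commutator_radialCutoff_le :
    ∃ C₁ : ℝ, 0 < C₁ ∧ ∀ r R : ℝ, 0 ≤ r → r < R →
      ∀ (f : EuclideanSpace ℝ (Fin 3) → EuclideanSpace ℝ (Fin 3)) (B t : ℝ), Continuous f → (∀ z, ‖f z‖ ≤ B) → 0 < t →
        ∀ x, ‖radialCutoff r R x • heatFlow f t x - heatFlow (fun y => radialCutoff r R y • f y) t x‖ ≤
          C₁ / (R - r) * B * (2 * (2 : ℝ) ^ ((Module.finrank ℝ (EuclideanSpace ℝ (Fin 3)) : ℝ) / 2) * t ^ (1 / 2 : ℝ)) := by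
  obtain ⟨C₁, hC₁, hC⟩ := exists_abs_radialCutoff_sub_le
  refine ⟨C₁, hC₁, fun r R hr hrR f B t hf hB ht x => ?_⟩
  exact norm_heatFlow_commutator_smul_le (radialCutoff_contDiff r R (n := 0)).continuous
    (div_nonneg hC₁.le (sub_pos.2 hrR).le) (hC r R hr hrR) (abs_radialCutoff_le_one r R) hf hB ht x

end Summit.NavierStokesRegularity.NavierStokesRegularity.Cruxes.TypeIQuantSubcubicExp.QuietCollar

end
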